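import Summits.RiemannHypothesis.RiemannHypothesis.Theses.LittlewoodRadar
import Summits.RiemannHypothesis.RiemannHypothesis.Theorems.LittlewoodRadarResidual
import HarnessLib

/-!
# `LittlewoodRadar.Assembly` (item stmt-RiemannHypothesis-24252) — glue closer

The assembly item of route `LittlewoodRadar` (L52 «LITTLEWOOD RADAR»),
`PintzLocalisation → DoorOfPintz → ThetaResidual → Summit.RiemannHypothesis`.
Proof-only revision 2026-08-30 (route lead rlead-rh-LittlewoodRadar g0): since route rev 4 the deciding
theorem `Theses.LittlewoodRadar.closes` has the RUNG type `PintzLocalisationPos → DoorOfPintzPos → ThetaRadarDoor`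
and no longer proves this (historical, summit-form) item directly; the statement is unchanged and is now closed
by the residual converse `Theorems.LittlewoodRadar.rh_of_thetaResidual` (door `h2 h1` + Schoenfeld-free
envelope argument, `LittlewoodRadarResidual.lean`) and `Summit.RiemannHypothesis_iff`.
Pure propositional glue over landed theorems; no analysis.  Nothing here bears on the truth of RH
(the hypothesis `PintzLocalisation` is moreover refuted, `LittlewoodRadarPintzRefutation.lean`).
-/

set_option linter.dupNamespace false  -- the mandated namespace repeats `RiemannHypothesis`

namespace Summit.RiemannHypothesis.RiemannHypothesis.Theorems.LittlewoodRadar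

/-- **`Assembly` (item stmt-RiemannHypothesis-24252) holds**: door, residual converse
(`rh_of_thetaResidual`) and `Summit.RiemannHypothesis_iff`. [folklore] -/
theorem assembly_proof : Summit.RiemannHypothesis.RiemannHypothesis.Theses.LittlewoodRadar.Assembly :=
  fun h1 h2 h3 => Summit.RiemannHypothesis_iff.mpr (rh_of_thetaResidual h1 h2 h3)

end Summit.RiemannHypothesis.RiemannHypothesis.Theorems.LittlewoodRadar
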